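import Literature.MathematicalPhysics.QuantumFieldTheory.Balaban1983to89.Beta.AliasingTailL1

/-!
# Beta / PolyRegularAlgebra — the (Z)-discharge ALGEBRA: poly-holomorphic scalar and matrix families on a polystrip, closed
# under the operations the one-loop integrands are built from (β sub-cell, CAP lane «KERNEL ALGEBRA + EXPORT», lineage
# `b2b-balaban-beta-cap3`, gen 8; node O-cap3-18, handed back by an5-g20, journal l.3383 (2); staged l.3487)

Every (S4) row of the cell (`CapRows.Rows.ofAliasingL1`, `CapRowsTail`, `CapRowsLattice.rowsOfCode16(E)` …) carries the
binder `StripRegularC G κ M` (`Beta.AliasingTailL1`): continuity of `G` on the closed polystrip `|Im q_μ| ≤ κ`, holomorphy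
of every coordinate slice through COMPLEX base points, matching values on the vertical sides `Re q_μ = ±π`, and `‖G‖ ≤ M`
there.  Its discharge for an actual integrand splits — as the cell's R15 discipline splits it — into a STRUCTURAL half (the
first three clauses, which follow from HOW `G` is built: finite sums of lattice characters `e^{i x·q}` with constant matrix
coefficients, matrix products, inverses of a matrix family whose determinant does not vanish on the polystrip, traces) and a
CERTIFICATE half (the number `M`, supplied by the engines and read by the referee).  This module is the structural half:
§1 `PolyHol G w` := `PolyRegular G w M` minus the bound; the polystrip is compact (`isCompact_polyStrip`), so a `PolyHol`
function is automatically bounded (`PolyHol.exists_bound`) and ANY certified bound turns it into the binder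
(`PolyHol.regular`, `PolyHol.stripRegularC`).  §2 scalar algebra: constants, lattice characters (`polyHol_character`),
`add`, `neg`, `sub`, `mul`, `const_mul`, finite `sum` ∕ `prod`, `pow`, `inv` ∕ `div` where the denominator does not vanish.
§3 matrix families `MatPolyHol A w` (entrywise): constants, character sums (`matPolyHol_characterSum` — the shape of every
engine stencil family `q ↦ Σ_{ΔR} K[ΔR] e^{i q·ΔR}`), `add`, `sub`, `mul`, `smul`, sums, `det`, `updateRow`, `adjugate`,
the INVERSE where `det (A q) ≠ 0` on the polystrip (`MatPolyHol.inv`, `A⁻¹ = (det A)⁻¹ • adj A`), `trace`; whence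
`polyHol_trace_resolvent` (`q ↦ tr((A q)⁻¹ B q)`, tadpole form), `polyHol_trace_bubble` (`q ↦ tr((A q)⁻¹ C q (A′ q)⁻¹ D q)`,
bubble form with the shifted family `A′`), and the binder-shaped `stripRegularC_trace_resolvent`, `stripRegularC_oneLoopForm`
(structure + (Z1) + ANY certified `M` ⇒ `StripRegularC (t₁ − t₂) κ M`).

HONEST FRAMING.  Kernel algebra only: no number of the β-function, no binder INSTANCE for the cell's actual integrand (its
matrix families live in the engines, not in Lean), no certificate.  The hypothesis `det (A q) ≠ 0` on the polystrip is the
cell's (Z1) (certified outside the kernel, CAP-KERNEL §7); the bound `M` is its (Z2) (CAP-KERNEL §4.10, §4.14).  Discharging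
`BetaPertH` would make Bałaban's ultraviolet stability unconditional — NOT the continuum limit and NOT the Clay problem.
Everything here is [folklore] complex analysis ∕ linear algebra over Mathlib; 0 `sorry`, 0 cite tags.
-/

namespace Summit.QuantumFields.BalabanUV.Beta.PolyRegularAlgebra

open Complex Set
open Literature.MathematicalPhysics.QuantumFieldTheory.Balaban1983to89
open B4Strip (ofRealVec Strip)
open B4ContourShift
open Beta.AliasingTailL1
open scoped Real

noncomputable section

variable {d : ℕ}

/-! ## §1 Geometry of the polystrip; `PolyHol` -/

/-- the coordinate box `|Re z| ≤ a`, `|Im z| ≤ b` is compact. [folklore] -/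
theorem isCompact_coordBox (a b : ℝ) : IsCompact {z : ℂ | |z.re| ≤ a ∧ |z.im| ≤ b} := by
  have e : {z : ℂ | |z.re| ≤ a ∧ |z.im| ≤ b} = (Icc (-a) a) ×ℂ (Icc (-b) b) := by
    ext z
    simp only [mem_setOf_eq, mem_reProdIm, mem_Icc, abs_le]
  rw [e]
  exact isCompact_Icc.reProdIm isCompact_Icc

/-- the polystrip is the product of its coordinate boxes. [folklore] -/
theorem polyStrip_eq_pi {n : ℕ} (w : Fin n → ℝ) :
    PolyStrip w = Set.pi Set.univ (fun μ => {z : ℂ | |z.re| ≤ π ∧ |z.im| ≤ w μ}) := by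
  ext p
  simp only [PolyStrip, mem_setOf_eq, mem_pi, mem_univ, true_implies]

/-- THE POLYSTRIP IS COMPACT. [folklore] -/
theorem isCompact_polyStrip {n : ℕ} (w : Fin n → ℝ) : IsCompact (PolyStrip w) := by
  rw [polyStrip_eq_pi]
  exact isCompact_univ_pi fun μ => isCompact_coordBox π (w μ)

/-- inserting a point of the closed rectangle of half-width `w_i ≥ 0` at coordinate `i` into a COMPLEX base point of the
polystrip in the remaining coordinates gives a point of the polystrip. [folklore] -/
theorem insertNth_mem_polyStrip' {w : Fin (d + 1) → ℝ} (i : Fin (d + 1)) (hw : 0 ≤ w i) {q : Fin d → ℂ}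
    (hq : q ∈ PolyStrip (fun j => w (i.succAbove j))) {z : ℂ} (hz : z ∈ closedRect (w i)) :
    i.insertNth z q ∈ PolyStrip w := by
  intro j
  refine Fin.succAboveCases i ?_ ?_ j
  · rw [Fin.insertNth_apply_same]
    have h1 := hz.1
    have h2 := hz.2
    simp only [mem_preimage] at h1 h2
    rw [uIcc_of_le (by linarith [Real.pi_pos] : -π ≤ π)] at h1
    rw [uIcc_of_le (by linarith [hw] : -w i ≤ w i)] at h2
    exact ⟨abs_le.mpr ⟨h1.1, h1.2⟩, abs_le.mpr ⟨h2.1, h2.2⟩⟩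
  · intro k
    rw [Fin.insertNth_apply_succAbove]
    exact hq k

/-- POLY-HOLOMORPHY of a multiplier `G` on the polystrip of half-widths `w`: `PolyRegular G w M` WITHOUT the bound —
continuity on the polystrip, holomorphy of every coordinate slice through complex base points on the open rectangle, and
matching values on the vertical sides.  This is the STRUCTURAL half of the (S4) binder. [folklore] -/
structure PolyHol (G : (Fin (d + 1) → ℂ) → ℂ) (w : Fin (d + 1) → ℝ) : Prop where
  cont : ContinuousOn G (PolyStrip w)
  diff : ∀ (i : Fin (d + 1)) (q : Fin d → ℂ), q ∈ PolyStrip (fun j => w (i.succAbove j)) →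
    DifferentiableOn ℂ (fun z => G (i.insertNth z q)) (openRect (w i))
  sides : ∀ (i : Fin (d + 1)) (q : Fin d → ℂ), q ∈ PolyStrip (fun j => w (i.succAbove j)) → ∀ y : ℝ, |y| ≤ w i →
    G (i.insertNth (-π + y * I) q) = G (i.insertNth (π + y * I) q)

/-- a poly-regular multiplier is poly-holomorphic. [folklore] -/
theorem polyHol_of_polyRegular {G : (Fin (d + 1) → ℂ) → ℂ} {w : Fin (d + 1) → ℝ} {M : ℝ} (h : PolyRegular G w M) :
    PolyHol G w :=
  ⟨h.cont, h.diff, h.sides⟩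

/-- STRUCTURE + CERTIFICATE ⇒ BINDER: a poly-holomorphic multiplier with ANY bound `M` on the polystrip is poly-regular
with that bound. [folklore] -/
theorem PolyHol.regular {G : (Fin (d + 1) → ℂ) → ℂ} {w : Fin (d + 1) → ℝ} {M : ℝ} (h : PolyHol G w)
    (hM : ∀ p ∈ PolyStrip w, ‖G p‖ ≤ M) : PolyRegular G w M :=
  ⟨h.cont, h.diff, h.sides, hM⟩

/-- the same with all half-widths `κ`: the cell's binder `StripRegularC G κ M`. [folklore] -/
theorem PolyHol.stripRegularC {G : (Fin (d + 1) → ℂ) → ℂ} {κ M : ℝ} (h : PolyHol G (fun _ => κ))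
    (hM : ∀ p ∈ Strip (d + 1) κ, ‖G p‖ ≤ M) : StripRegularC G κ M :=
  h.regular hM

/-- a poly-holomorphic multiplier IS bounded on the (compact) polystrip. [folklore] -/
theorem PolyHol.exists_bound {G : (Fin (d + 1) → ℂ) → ℂ} {w : Fin (d + 1) → ℝ} (h : PolyHol G w) :
    ∃ M, 0 ≤ M ∧ ∀ p ∈ PolyStrip w, ‖G p‖ ≤ M := by
  obtain ⟨M, hM⟩ := (isCompact_polyStrip w).exists_bound_of_continuousOn h.cont
  exact ⟨max M 0, le_max_right _ _, fun p hp => (hM p hp).trans (le_max_left _ _)⟩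

/-- hence poly-regular with SOME nonnegative bound. [folklore] -/
theorem PolyHol.exists_polyRegular {G : (Fin (d + 1) → ℂ) → ℂ} {w : Fin (d + 1) → ℝ} (h : PolyHol G w) :
    ∃ M, 0 ≤ M ∧ PolyRegular G w M := by
  obtain ⟨M, hM0, hM⟩ := h.exists_bound
  exact ⟨M, hM0, h.regular hM⟩

/-! ## §2 Scalar algebra -/

section Scalar

variable {G G₁ G₂ F : (Fin (d + 1) → ℂ) → ℂ} {w : Fin (d + 1) → ℝ}

/-- constants. [folklore] -/
theorem polyHol_const (a : ℂ) (w : Fin (d + 1) → ℝ) : PolyHol (fun _ : Fin (d + 1) → ℂ => a) w :=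
  ⟨continuousOn_const, fun _ _ _ => differentiableOn_const a, fun _ _ _ _ _ => rfl⟩

/-- sums. [folklore] -/
theorem PolyHol.add (h₁ : PolyHol G₁ w) (h₂ : PolyHol G₂ w) : PolyHol (fun p => G₁ p + G₂ p) w := by
  refine ⟨h₁.cont.add h₂.cont, fun i q hq => (h₁.diff i q hq).add (h₂.diff i q hq), ?_⟩
  intro i q hq y hy
  show _ = _
  rw [h₁.sides i q hq y hy, h₂.sides i q hq y hy]

/-- products. [folklore] -/
theorem PolyHol.mul (h₁ : PolyHol G₁ w) (h₂ : PolyHol G₂ w) : PolyHol (fun p => G₁ p * G₂ p) w := by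
  refine ⟨h₁.cont.mul h₂.cont, fun i q hq => (h₁.diff i q hq).mul (h₂.diff i q hq), ?_⟩
  intro i q hq y hy
  show _ = _
  rw [h₁.sides i q hq y hy, h₂.sides i q hq y hy]

/-- negation. [folklore] -/
theorem PolyHol.neg (h : PolyHol G w) : PolyHol (fun p => -G p) w := by
  refine ⟨h.cont.neg, fun i q hq => (h.diff i q hq).neg, ?_⟩
  intro i q hq y hy
  show _ = _
  rw [h.sides i q hq y hy]

/-- differences. [folklore] -/
theorem PolyHol.sub (h₁ : PolyHol G₁ w) (h₂ : PolyHol G₂ w) : PolyHol (fun p => G₁ p - G₂ p) w := by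
  refine ⟨h₁.cont.sub h₂.cont, fun i q hq => (h₁.diff i q hq).sub (h₂.diff i q hq), ?_⟩
  intro i q hq y hy
  show _ = _
  rw [h₁.sides i q hq y hy, h₂.sides i q hq y hy]

/-- constant multiples. [folklore] -/
theorem PolyHol.const_mul (h : PolyHol G w) (a : ℂ) : PolyHol (fun p => a * G p) w :=
  (polyHol_const a w).mul h

/-- FINITE SUMS. [folklore] -/
theorem PolyHol.sum {ι : Type*} (s : Finset ι) {H : ι → (Fin (d + 1) → ℂ) → ℂ}
    (h : ∀ k ∈ s, PolyHol (H k) w) : PolyHol (fun p => ∑ k ∈ s, H k p) w := by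
  classical
  revert h
  refine Finset.induction_on s ?_ ?_
  · intro _
    simp only [Finset.sum_empty]
    exact polyHol_const 0 w
  · intro a s ha ih h
    have e : (fun p => ∑ k ∈ insert a s, H k p) = fun p => H a p + ∑ k ∈ s, H k p := by funext p; rw [Finset.sum_insert ha]
    rw [e]
    exact (h a (Finset.mem_insert_self a s)).add (ih fun k hk => h k (Finset.mem_insert_of_mem hk))

/-- FINITE PRODUCTS. [folklore] -/
theorem PolyHol.prod {ι : Type*} (s : Finset ι) {H : ι → (Fin (d + 1) → ℂ) → ℂ}
    (h : ∀ k ∈ s, PolyHol (H k) w) : PolyHol (fun p => ∏ k ∈ s, H k p) w := by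
  classical
  revert h
  refine Finset.induction_on s ?_ ?_
  · intro _
    simp only [Finset.prod_empty]
    exact polyHol_const 1 w
  · intro a s ha ih h
    have e : (fun p => ∏ k ∈ insert a s, H k p) = fun p => H a p * ∏ k ∈ s, H k p := by funext p; rw [Finset.prod_insert ha]
    rw [e]
    exact (h a (Finset.mem_insert_self a s)).mul (ih fun k hk => h k (Finset.mem_insert_of_mem hk))

/-- powers. [folklore] -/
theorem PolyHol.pow (h : PolyHol G w) (n : ℕ) : PolyHol (fun p => G p ^ n) w := by
  induction n with
  | zero =>
    simp only [pow_zero]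
    exact polyHol_const 1 w
  | succ n ih =>
    have e : (fun p => G p ^ (n + 1)) = fun p => G p ^ n * G p := by funext p; rw [pow_succ]
    rw [e]
    exact ih.mul h

/-- INVERSE OF A NON-VANISHING poly-holomorphic function (nonnegative half-widths, so that the open slices lie in the
polystrip). [folklore] -/
theorem PolyHol.inv (h : PolyHol F w) (hw : ∀ j, 0 ≤ w j) (hne : ∀ p ∈ PolyStrip w, F p ≠ 0) :
    PolyHol (fun p => (F p)⁻¹) w := by
  refine ⟨h.cont.inv₀ hne, ?_, ?_⟩
  · intro i q hq
    refine (h.diff i q hq).inv ?_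
    intro z hz
    exact hne _ (insertNth_mem_polyStrip' i (hw i) hq (openRect_subset_closedRect (w i) hz))
  · intro i q hq y hy
    show _ = _
    rw [h.sides i q hq y hy]

/-- quotients by a non-vanishing poly-holomorphic function. [folklore] -/
theorem PolyHol.div (h₁ : PolyHol G w) (h₂ : PolyHol F w) (hw : ∀ j, 0 ≤ w j) (hne : ∀ p ∈ PolyStrip w, F p ≠ 0) :
    PolyHol (fun p => G p / F p) w := by
  have e : (fun p => G p / F p) = fun p => G p * (F p)⁻¹ := by funext p; rw [div_eq_mul_inv]
  rw [e]
  exact h₁.mul (h₂.inv hw hne)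

/-- the LATTICE CHARACTER `q ↦ e^{i x·q}` of an integer vector `x`. [folklore] -/
def character (x : Fin (d + 1) → ℤ) (p : Fin (d + 1) → ℂ) : ℂ := cexp (I * ∑ μ, (x μ : ℂ) * p μ)

/-- the exponent of a character along a coordinate slice is affine in the slice variable. [folklore] -/
theorem character_insertNth (x : Fin (d + 1) → ℤ) (i : Fin (d + 1)) (z : ℂ) (q : Fin d → ℂ) :
    character x (i.insertNth z q) = cexp (I * ((x i : ℂ) * z + ∑ k, (x (i.succAbove k) : ℂ) * q k)) := by
  unfold character
  congr 2
  rw [Fin.sum_univ_succAbove _ i, Fin.insertNth_apply_same]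
  congr 1
  refine Finset.sum_congr rfl fun k _ => ?_
  rw [Fin.insertNth_apply_succAbove]

/-- LATTICE CHARACTERS ARE POLY-HOLOMORPHIC on every polystrip (entire and `2π`-periodic in each coordinate). [folklore] -/
theorem polyHol_character (x : Fin (d + 1) → ℤ) (w : Fin (d + 1) → ℝ) : PolyHol (character x) w := by
  refine ⟨?_, ?_, ?_⟩
  · apply Continuous.continuousOn
    unfold character
    fun_prop
  · intro i q _
    have e : (fun z => character x (i.insertNth z q)) =
        fun z => cexp (I * ((x i : ℂ) * z + ∑ k, (x (i.succAbove k) : ℂ) * q k)) := by funext z; exact character_insertNth x i z q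
    rw [e]
    apply Differentiable.differentiableOn
    fun_prop
  · intro i q _ y _
    rw [character_insertNth, character_insertNth, Complex.exp_eq_exp_iff_exists_int]
    refine ⟨-(x i), ?_⟩
    push_cast
    ring

end Scalar

/-! ## §3 Matrix families -/

section Matrix

variable {n : Type*}
variable {A A' B C D : (Fin (d + 1) → ℂ) → Matrix n n ℂ} {w : Fin (d + 1) → ℝ}

/-- a MATRIX FAMILY on the polystrip is poly-holomorphic when every entry is. [folklore] -/
def MatPolyHol (A : (Fin (d + 1) → ℂ) → Matrix n n ℂ) (w : Fin (d + 1) → ℝ) : Prop :=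
  ∀ i j, PolyHol (fun p => A p i j) w

/-- constant families. [folklore] -/
theorem matPolyHol_const (K : Matrix n n ℂ) (w : Fin (d + 1) → ℝ) :
    MatPolyHol (fun _ : Fin (d + 1) → ℂ => K) w :=
  fun i j => polyHol_const (K i j) w

/-- sums. [folklore] -/
theorem MatPolyHol.add (hA : MatPolyHol A w) (hB : MatPolyHol B w) : MatPolyHol (fun p => A p + B p) w :=
  fun i j => by
    simp only [Matrix.add_apply]
    exact (hA i j).add (hB i j)

/-- differences. [folklore] -/
theorem MatPolyHol.sub (hA : MatPolyHol A w) (hB : MatPolyHol B w) : MatPolyHol (fun p => A p - B p) w :=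
  fun i j => by
    simp only [Matrix.sub_apply]
    exact (hA i j).sub (hB i j)

/-- scalar multiples by a poly-holomorphic function. [folklore] -/
theorem MatPolyHol.smul (hA : MatPolyHol A w) {g : (Fin (d + 1) → ℂ) → ℂ} (hg : PolyHol g w) :
    MatPolyHol (fun p => g p • A p) w :=
  fun i j => by
    simp only [Matrix.smul_apply, smul_eq_mul]
    exact hg.mul (hA i j)

/-- MATRIX PRODUCTS. [folklore] -/
theorem MatPolyHol.mul [Fintype n] (hA : MatPolyHol A w) (hB : MatPolyHol B w) : MatPolyHol (fun p => A p * B p) w :=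
  fun i j => by
    simp only [Matrix.mul_apply]
    exact PolyHol.sum _ fun k _ => (hA i k).mul (hB k j)

/-- finite sums of matrix families. [folklore] -/
theorem MatPolyHol.sum {ι : Type*} (s : Finset ι) {H : ι → (Fin (d + 1) → ℂ) → Matrix n n ℂ}
    (h : ∀ k ∈ s, MatPolyHol (H k) w) : MatPolyHol (fun p => ∑ k ∈ s, H k p) w :=
  fun i j => by
    simp only [Matrix.sum_apply]
    exact PolyHol.sum s fun k hk => h k hk i j

/-- CHARACTER SUMS `q ↦ Σ_{x ∈ S} e^{i x·q} • K x` with constant matrix coefficients — the shape of every stencil family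
of the engines (`k₀`, `k_s`, `k_t`, `k_st` as functions of the fine Bloch momentum) — are poly-holomorphic on every
polystrip. [folklore] -/
theorem matPolyHol_characterSum (S : Finset (Fin (d + 1) → ℤ)) (K : (Fin (d + 1) → ℤ) → Matrix n n ℂ)
    (w : Fin (d + 1) → ℝ) : MatPolyHol (fun p => ∑ x ∈ S, character x p • K x) w :=
  MatPolyHol.sum S fun x _ => (matPolyHol_const (K x) w).smul (polyHol_character x w)

/-- THE DETERMINANT of a poly-holomorphic matrix family is poly-holomorphic. [folklore] -/
theorem MatPolyHol.det [Fintype n] [DecidableEq n] (hA : MatPolyHol A w) : PolyHol (fun p => (A p).det) w := by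
  have e : (fun p => (A p).det) =
      fun p => ∑ σ : Equiv.Perm n, ((Equiv.Perm.sign σ : ℤ) : ℂ) * ∏ i, A p (σ i) i := by
    funext p
    rw [Matrix.det_apply]
    exact Finset.sum_congr rfl fun σ _ => by rw [Units.smul_def, zsmul_eq_mul]
  rw [e]
  exact PolyHol.sum _ fun σ _ => (PolyHol.prod _ fun i _ => hA (σ i) i).const_mul _

/-- replacing a row by a constant row keeps poly-holomorphy. [folklore] -/
theorem MatPolyHol.updateRow [DecidableEq n] (hA : MatPolyHol A w) (j : n) (v : n → ℂ) :
    MatPolyHol (fun p => (A p).updateRow j v) w :=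
  fun i k => by
    by_cases hij : i = j
    · subst hij
      simp only [Matrix.updateRow_self]
      exact polyHol_const _ _
    · simp only [Matrix.updateRow_ne hij]
      exact hA i k

/-- THE ADJUGATE of a poly-holomorphic matrix family is poly-holomorphic. [folklore] -/
theorem MatPolyHol.adjugate [Fintype n] [DecidableEq n] (hA : MatPolyHol A w) : MatPolyHol (fun p => (A p).adjugate) w :=
  fun i j => by
    simp only [Matrix.adjugate_apply]
    exact (hA.updateRow j (Pi.single i 1)).det

/-- THE INVERSE of a poly-holomorphic matrix family whose DETERMINANT DOES NOT VANISH on the polystrip (nonnegative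
half-widths) is poly-holomorphic — `A⁻¹ = (det A)⁻¹ • adj A`.  (For the cell: the hypothesis is (Z1), the certified
zero-freeness of `det 𝒦` on the polystrip, CAP-KERNEL §7.) [folklore] -/
theorem MatPolyHol.inv [Fintype n] [DecidableEq n] (hA : MatPolyHol A w) (hw : ∀ j, 0 ≤ w j) (hdet : ∀ p ∈ PolyStrip w, (A p).det ≠ 0) :
    MatPolyHol (fun p => (A p)⁻¹) w :=
  fun i j => by
    have e : (fun p => (A p)⁻¹ i j) = fun p => ((A p).det)⁻¹ * (A p).adjugate i j := by funext p; rw [Matrix.inv_def, Matrix.smul_apply, smul_eq_mul, Ring.inverse_eq_inv']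
    rw [e]
    exact (hA.det.inv hw hdet).mul (hA.adjugate i j)

/-- THE TRACE of a poly-holomorphic matrix family is poly-holomorphic. [folklore] -/
theorem MatPolyHol.trace [Fintype n] (hA : MatPolyHol A w) : PolyHol (fun p => (A p).trace) w := by
  have e : (fun p => (A p).trace) = fun p => ∑ i, A p i i := by funext p; rfl
  rw [e]
  exact PolyHol.sum _ fun i _ => hA i i

/-- THE TADPOLE FORM `q ↦ tr((A q)⁻¹ B q)` is poly-holomorphic when `A`, `B` are and `det A ≠ 0` on the polystrip. [folklore] -/
theorem polyHol_trace_resolvent [Fintype n] [DecidableEq n] (hA : MatPolyHol A w) (hB : MatPolyHol B w) (hw : ∀ j, 0 ≤ w j)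
    (hdet : ∀ p ∈ PolyStrip w, (A p).det ≠ 0) : PolyHol (fun p => ((A p)⁻¹ * B p).trace) w :=
  ((hA.inv hw hdet).mul hB).trace

/-- THE BUBBLE FORM `q ↦ tr((A q)⁻¹ C q (A′ q)⁻¹ D q)` (two resolvents — for the cell, `A′ q = k₀(q − p)` is the
shifted family, itself a character sum) is poly-holomorphic when all four families are and both determinants are
zero-free on the polystrip. [folklore] -/
theorem polyHol_trace_bubble [Fintype n] [DecidableEq n] (hA : MatPolyHol A w) (hA' : MatPolyHol A' w) (hC : MatPolyHol C w) (hD : MatPolyHol D w)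
    (hw : ∀ j, 0 ≤ w j) (hdet : ∀ p ∈ PolyStrip w, (A p).det ≠ 0) (hdet' : ∀ p ∈ PolyStrip w, (A' p).det ≠ 0) :
    PolyHol (fun p => ((A p)⁻¹ * C p * (A' p)⁻¹ * D p).trace) w :=
  ((((hA.inv hw hdet).mul hC).mul (hA'.inv hw hdet')).mul hD).trace

/-- BINDER-SHAPED CONCLUSION, tadpole form: structure + (Z1) + ANY certified bound `M` on the strip ⇒
`StripRegularC (q ↦ tr((A q)⁻¹ B q)) κ M`. [folklore] -/
theorem stripRegularC_trace_resolvent [Fintype n] [DecidableEq n] {κ M : ℝ} (hκ : 0 ≤ κ) (hA : MatPolyHol A (fun _ => κ))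
    (hB : MatPolyHol B (fun _ => κ)) (hdet : ∀ p ∈ Strip (d + 1) κ, (A p).det ≠ 0)
    (hM : ∀ p ∈ Strip (d + 1) κ, ‖((A p)⁻¹ * B p).trace‖ ≤ M) :
    StripRegularC (fun p => ((A p)⁻¹ * B p).trace) κ M :=
  (polyHol_trace_resolvent hA hB (fun _ => hκ) hdet).stripRegularC hM

/-- BINDER-SHAPED CONCLUSION, the ONE-LOOP FORM `t₁ − t₂ = tr(A⁻¹ B_st) − tr(A⁻¹ B_s A′⁻¹ B_t)`: structure + (Z1) for
both resolvent families + ANY certified bound `M` on the strip ⇒ `StripRegularC (t₁ − t₂) κ M`.  (The cell's integrand is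
this with `A = k₀`, `A′ = k₀(· − p)`, and for the JET functional the `[p₁p₂]`-coefficient of it, a finite combination of
the same forms — §2–§3 close under all of these.) [folklore] -/
theorem stripRegularC_oneLoopForm [Fintype n] [DecidableEq n] {κ M : ℝ} (hκ : 0 ≤ κ) (hA : MatPolyHol A (fun _ => κ))
    (hA' : MatPolyHol A' (fun _ => κ)) (hBst : MatPolyHol B (fun _ => κ)) (hBs : MatPolyHol C (fun _ => κ))
    (hBt : MatPolyHol D (fun _ => κ)) (hdet : ∀ p ∈ Strip (d + 1) κ, (A p).det ≠ 0)
    (hdet' : ∀ p ∈ Strip (d + 1) κ, (A' p).det ≠ 0)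
    (hM : ∀ p ∈ Strip (d + 1) κ, ‖((A p)⁻¹ * B p).trace - ((A p)⁻¹ * C p * (A' p)⁻¹ * D p).trace‖ ≤ M) :
    StripRegularC (fun p => ((A p)⁻¹ * B p).trace - ((A p)⁻¹ * C p * (A' p)⁻¹ * D p).trace) κ M :=
  ((polyHol_trace_resolvent hA hBst (fun _ => hκ) hdet).sub
    (polyHol_trace_bubble hA hA' hBs hBt (fun _ => hκ) hdet hdet')).stripRegularC hM

end Matrix

end

end Summit.QuantumFields.BalabanUV.Beta.PolyRegularAlgebra
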